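import Summits.QuantumFields.BalabanUV.T4Continuum.Spine.NE3.PairThm4AtB8
import Literature.MathematicalPhysics.QuantumFieldTheory.Balaban1983to89.B9Eq335AxialCriterion
import HarnessLib

/-!
# T⁴ programme, node NE3 (pub-ymgap DAG node N16) — [B8] (1.33), SECOND CLAUSE «U₀ satisfies the regularity condition (3.35) in [4]»,
# DISCHARGED AT THE MINIMISER PAIR: the background `W = rescale L (bavg L U_B)`, the minimiser `U_A` and its axial pre-gauge copy `U_A^{u₀}`
# satisfy `B8Eq133Hypotheses.Reg335Zd (Lᵏ)⁻¹ L 𝒬 C` for every indexed cube family of `ℓ¹`-radius `≤ M·Lʲ`, `j ≤ k`, from the (H3ˢᵘᵖ) letters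
# ALONE; and g0's capstone `PairThm4AtB8.concl_of_thm4At_minimisers` re-issued with `Reg := Reg335Zd …` and NO background hypothesis (`PairReg335B8`)

Cell `pub-ymgap`, HUMAN RULING D-0062, seat `pub-ymgap-dag-n16-b` (FIRST-MISSING-ESTIMATE for N16 = NE3; writer prover-pub-ymgap-dag-n16-b-g2-0,
2026-08-26).  Companion of this seat's g0 files `Spine/NE3/PairClassAkB8` ((1.33)∕(1.34) `𝔄_k`-clauses at the pair), `Spine/NE3/PairThm4AtB8`
(the N05 → N16 edge BY NAME: [B8] Thm 4's typed interface `B8Eq119TwistedAxial.Thm4At L k (Lᵏ)⁻¹ c₁ G a M ρ Reg Restr Concl` applies at the pair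
GIVEN `Reg W`), and of the Literature criterion `B9Eq335AxialCriterion.reg335Zd_of_plaq_radii` (this seat, g2): (3.35) from the plaquette
radius and the transported plaquette-gradient radius in B7's complete axial gauge.

WHY.  [B8] Thm 4's hypothesis (1.33) on the background is `U₀ ∈ 𝔄_k({Ω_j}, α₀)` AND «U₀ satisfies the regularity condition (3.35) in [4]»
(the latter feeds [4]'s propagator theorems inside Prop. 5).  Print derives the second clause from the first via Theorem 4 at the trivial
background (Prop. 6, p. 99) — for node N16 that would be one more use of the N05 interface.  At NE3's pair it is FREE: the END's own leaf
(H3ˢᵘᵖ) (`LeafIndexSockets.LeafH3sup` = [B11] Thm 1 (8)+(10) TYPE, `MinimalActionRefine.RegularSup`) gives `U_B` (and `U_A`) a plaquette radius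
AND a flux-gradient radius, which one block averaging transports to `W` (`NE3AveragedGradientRadius`, `MinimalActionRate.rescale_bavg_mem_sfClass`),
and the Literature criterion turns the two radii into (3.35) on every cube family — so the concrete `Reg := Reg335Zd (Lᵏ)⁻¹ L 𝒬 C` of r05's
typed (1.33) (`B8Eq133Hypotheses.Hyp133`) costs N16 NOTHING beyond the letters it already holds.

WHAT ([folklore]; 0 def, 0 sorry):
* §1 `reg335Zd_of_smallField_plaqGrad` — the criterion in row NE3's letters: `IsUnitaryCfg V`, `SmallField V (α₀∕(Lᵏ)²)`, plaquette-gradient radius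
  `c₀∕(Lᵏ)³`, `(M+1)α₀ ≤ ½` ⇒ `Reg335Zd (Lᵏ)⁻¹ L 𝒬 C V` for every family `𝒬` of pairs `(□, j)`, `j ≤ k`, `□` inside an `ℓ¹`-ball of radius `M·Lʲ`,
  and every `C > 2(M+1)α₀ + 2Mc₀ + 4M(1+2M)α₀²`; `l1_le_of_box` — boxes of side `r` have `ℓ¹`-radius `≤ d·r`.
* §2 AT THE PAIR: `reg335Zd_rescale_bavg` — `W = rescale L (bavg L U_B)` from `RegularSup d L N b c (k+1) U_B` + (Rb), radii
  `(α₀, c₀) = (b + 226(8(d+1)(d+4))²b², 2(c + curConst·b²))`; `reg335Zd_of_regularSup` — `U_A` from `RegularSup d L N b c k U_A`, radii `(b, 2c)`;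
  `reg335Zd_gaugeAct_of_regularSup` — the same for `U_A^{u₀}`, any unitary-valued `u₀` (gauge invariance, `B9Eq335AxialCriterion.reg335Zd_gaugeAct`).
* §3 **`concl_of_thm4At_minimisers_reg335`** — g0's capstone with `Reg := Reg335Zd (Lᵏ)⁻¹ L 𝒬 C`: IF [B8] Theorem 4 holds at level `k` in the typed
  form `Thm4At L k (Lᵏ)⁻¹ c₁ unitaryUnits a M ρ (Reg335Zd (Lᵏ)⁻¹ L 𝒬 C) Restr Concl` for a cube family `𝒬` of `ℓ¹`-radius parameter `Mc` and a
  constant `C` above the pair's threshold, THEN its conclusion holds at the pair — NO hypothesis on the background is left: everything on N16's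
  side of the N05 → N16 edge except `Thm4At` itself (and Prop. 3's `grad ∕ holder`, and the `Concl → LandauRepB8Avg` dictionary) is a theorem.
HONEST FRAMING (page 1): `Thm4At` ([B8] Thm 4 at a curved background, N05's) is a HYPOTHESIS; the (H3ˢᵘᵖ) letters are [B11] Thm 1 TYPE
hypotheses (N07's); (3.35) here is OUR elementary road (axial gauge + flux-gradient letter), NOT print's Prop.-6 road; (3.36) is not touched;
Theorem 4 ∕ Theorem 2 ∕ NE3 NOT proved; spine 0∕9; finite T⁴ rung (B)+1 at fixed ε — NOT infinite volume, NOT mass gap, NOT `BetaPertH`, NOT Clay.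
PLACEMENT: `Spine/NE3/` (next to its g0 companions).
-/

set_option autoImplicit false

open scoped BigOperators Matrix Matrix.Norms.L2Operator
open NormedSpace

namespace Summit.QuantumFields.BalabanUV.T4Continuum.NE3.PairReg335B8

open Literature.MathematicalPhysics.QuantumFieldTheory.Balaban1983to89
open B7Prop1Explicit B7Prop2Explicit
open B8Lemma1NonAbelian (pert)
open B8Eq131Cubes (cube)
open B8Eq119TwistedAxial (Thm4At)
open B8Eq166ConstraintPair (ptw)
open B8Eq133Hypotheses (Reg335Zd)
open B9Eq335AxialCriterion (reg335Zd_of_plaq_radii reg335Zd_gaugeAct)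
open T4AveragingDeficitWall (IsUnitaryCfg SmallField Ad Plane flux covGrad)
open AveragingDeficitTransport (mem_U1_of_unitary)
open MinimalActionSandwich (IsMinimiser)
open MinimalActionRate (Regular sfClass rescale_bavg_mem_sfClass)
open MinimalActionRefine (RegularSup)
open BlockAverageCurrent (curConst curConst_nonneg)
open NE3FluxGradientDictionary (norm_Ad_hol_sub_hol_le_of_fluxGrad)
open NE3AveragedGradientRadius (norm_plaqGrad_rescale_bavg_le_scaled)
open NE3.PairThm4AtB8 (concl_of_thm4At_minimisers)

noncomputable section

variable {d : ℕ} {n : Type*} [Fintype n] [DecidableEq n]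

/-! ## §1 The (3.35) criterion in row NE3's letters -/

/-- **(3.35) FROM ROW NE3's TWO RADII** (`𝔸 = M_N(ℂ)`, unitary configurations): `SmallField V (α₀∕(Lᵏ)²)` and a plaquette-gradient radius
`c₀∕(Lᵏ)³` give `Reg335Zd (Lᵏ)⁻¹ L 𝒬 C V` for every family of pairs `(□, j)` with `j ≤ k` and `□` inside an `ℓ¹`-ball of radius `M·Lʲ`, every
`C > 2(M+1)α₀ + 2Mc₀ + 4M(1+2M)α₀²`, provided `(M+1)α₀ ≤ ½` (`B9Eq335AxialCriterion.reg335Zd_of_plaq_radii` at `η = (Lᵏ)⁻¹`). [folklore] -/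
theorem reg335Zd_of_smallField_plaqGrad [Nonempty n] {V : Site d → Fin d → (Matrix n n ℂ)ˣ} (hV : IsUnitaryCfg V)
    {L : ℕ} (hL : 1 ≤ L) (k : ℕ) {α₀ c₀ M : ℝ} (hα₀ : 0 ≤ α₀) (hc₀ : 0 ≤ c₀) (hM : 0 ≤ M)
    (hsmall : (M + 1) * α₀ ≤ 1 / 2) (hS : SmallField V (α₀ / ((L : ℝ) ^ k) ^ 2))
    (hG : ∀ (p : Site d) (μ : Fin d) {κ ν : Fin d}, κ ≠ ν →
      ‖Ad (V p μ) ((hol V (p + e μ) (plaqWord κ ν) : (Matrix n n ℂ)ˣ) : Matrix n n ℂ)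
        - ((hol V p (plaqWord κ ν) : (Matrix n n ℂ)ˣ) : Matrix n n ℂ)‖ ≤ c₀ / ((L : ℝ) ^ k) ^ 3)
    {𝒬 : Set (Set (Site d) × ℕ)}
    (h𝒬 : ∀ q ∈ 𝒬, q.2 ≤ k ∧ ∃ y : Site d, ∀ z ∈ q.1, (l1 (z - y) : ℝ) ≤ M * (L : ℝ) ^ q.2)
    {C : ℝ} (hC : 2 * (M + 1) * α₀ + 2 * M * c₀ + 4 * M * (1 + 2 * M) * α₀ ^ 2 < C) :
    Reg335Zd (((L : ℝ) ^ k)⁻¹) L 𝒬 C V := by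
  letI : CStarAlgebra (Matrix n n ℂ) := {}
  have hL1 : (1 : ℝ) ≤ L := by exact_mod_cast hL
  have hLk : (1 : ℝ) ≤ (L : ℝ) ^ k := one_le_pow₀ hL1
  have hLk0 : (0 : ℝ) < (L : ℝ) ^ k := by positivity
  have hη : (0 : ℝ) < ((L : ℝ) ^ k)⁻¹ := by positivity
  have hη1 : ((L : ℝ) ^ k)⁻¹ ≤ 1 := inv_le_one_of_one_le₀ hLk
  have hU1 : ∀ x κ, V x κ ∈ U1 (Matrix n n ℂ) := fun x κ => mem_U1_of_unitary (hV x κ)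
  have h44 : ∀ (x : Site d) (κ μ : Fin d), κ ≠ μ →
      ‖((hol V x (plaqWord κ μ) : (Matrix n n ℂ)ˣ) : Matrix n n ℂ) - 1‖ ≤ α₀ * (((L : ℝ) ^ k)⁻¹) ^ 2 := by
    intro x κ μ hκμ
    have h := hS x κ μ hκμ
    rwa [div_eq_mul_inv, ← inv_pow] at h
  have hG' : ∀ (p : Site d) (ν κ μ : Fin d), κ ≠ μ →
      ‖(V p ν : Matrix n n ℂ) * ((hol V (p + e ν) (plaqWord κ μ) : (Matrix n n ℂ)ˣ) : Matrix n n ℂ) *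
          (((V p ν)⁻¹ : (Matrix n n ℂ)ˣ) : Matrix n n ℂ) - ((hol V p (plaqWord κ μ) : (Matrix n n ℂ)ˣ) : Matrix n n ℂ)‖ ≤
        c₀ * (((L : ℝ) ^ k)⁻¹) ^ 3 := by
    intro p ν κ μ hκμ
    have h := hG p ν hκμ
    rw [div_eq_mul_inv, ← inv_pow] at h
    exact h
  have h𝒬' : ∀ q ∈ 𝒬, (L : ℝ) ^ q.2 * ((L : ℝ) ^ k)⁻¹ ≤ 1 ∧ ∃ y : Site d, ∀ z ∈ q.1, (l1 (z - y) : ℝ) ≤ M * (L : ℝ) ^ q.2 := by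
    intro q hq
    obtain ⟨hj, hy⟩ := h𝒬 q hq
    refine ⟨?_, hy⟩
    rw [mul_inv_le_iff₀ hLk0, one_mul]
    exact pow_le_pow_right₀ hL1 hj
  exact reg335Zd_of_plaq_radii hU1 hη hη1 hL hα₀ hc₀ hM hsmall h44 hG' h𝒬' hC

omit [Fintype n] [DecidableEq n] in
/-- Boxes have small `ℓ¹`-radius: if every coordinate of `v` is at most `r` in absolute value then `|v|₁ ≤ d·r` — so the cubes of [4] p. 396
(boxes of side `≍ M·Lʲ` lattice units about a corner or centre `y`) fall under §1 with `M ↦ d·M`. [folklore] -/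
theorem l1_le_of_box {v : Site d} {r : ℕ} (h : ∀ i, |v i| ≤ (r : ℤ)) : l1 v ≤ d * r := by
  have h' : ∀ i, (v i).natAbs ≤ r := fun i => by
    have := h i
    rw [← Int.natCast_natAbs] at this
    exact_mod_cast this
  unfold l1
  calc ∑ i, (v i).natAbs ≤ ∑ _i : Fin d, r := Finset.sum_le_sum fun i _ => h' i
    _ = d * r := by simp

/-! ## §2 At the minimiser pair: the background `W`, the minimiser `U_A`, and `U_A^{u₀}` -/

/-- **(3.35) FOR THE BACKGROUND `W = rescale L (bavg L U_B)`** at level `k` (`η = (Lᵏ)⁻¹`) from `U_B`'s sup-regularity letters at level `k + 1`: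
`RegularSup d L N b c (k+1) U_B`, (Rb) `2¹⁵(d+1)²(d+4)²L²b ≤ 1`, a cube family `𝒬` (`j ≤ k`, `ℓ¹`-radius `≤ M·Lʲ`) with `(M+1)·α_W ≤ ½`,
`α_W := b + 226(8(d+1)(d+4))²b²`, and any `C > 2(M+1)α_W + 2M·c_W + 4M(1+2M)α_W²`, `c_W := 2(c + curConst·b²)` ⇒ `Reg335Zd (Lᵏ)⁻¹ L 𝒬 C W` —
the second clause of (1.33) for Theorem 4 at the pair's background. [folklore] -/
theorem reg335Zd_rescale_bavg [Nonempty n] {L N : ℕ} (hL : 1 ≤ L) {k : ℕ} {UB : Site d → Fin d → (Matrix n n ℂ)ˣ} {b c : ℝ}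
    (hreg : RegularSup d L N b c (k + 1) UB) (hb : 0 ≤ b) (hc : 0 ≤ c)
    (hRb : 2 ^ 15 * ((d : ℝ) + 1) ^ 2 * ((d : ℝ) + 4) ^ 2 * (L : ℝ) ^ 2 * b ≤ 1)
    {M : ℝ} (hM : 0 ≤ M) (hsmall : (M + 1) * (b + 226 * (8 * (d + 1) * (d + 4)) ^ 2 * b ^ 2) ≤ 1 / 2)
    {𝒬 : Set (Set (Site d) × ℕ)}
    (h𝒬 : ∀ q ∈ 𝒬, q.2 ≤ k ∧ ∃ y : Site d, ∀ z ∈ q.1, (l1 (z - y) : ℝ) ≤ M * (L : ℝ) ^ q.2)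
    {C : ℝ} (hC : 2 * (M + 1) * (b + 226 * (8 * (d + 1) * (d + 4)) ^ 2 * b ^ 2) + 2 * M * (2 * (c + curConst d L * b ^ 2)) +
      4 * M * (1 + 2 * M) * (b + 226 * (8 * (d + 1) * (d + 4)) ^ 2 * b ^ 2) ^ 2 < C) :
    Reg335Zd (((L : ℝ) ^ k)⁻¹) L 𝒬 C (rescale L (bavg L UB)) := by
  have hbs : 512 * (d + 1) * (d + 4) * (L : ℝ) ^ 2 * b ≤ 1 := by
    have h1 : (512 : ℝ) * (d + 1) * (d + 4) * (L : ℝ) ^ 2 * b ≤ 2 ^ 15 * ((d : ℝ) + 1) ^ 2 * ((d : ℝ) + 4) ^ 2 * (L : ℝ) ^ 2 * b := by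
      have hd0 : (0 : ℝ) ≤ d := Nat.cast_nonneg d
      have : (512 : ℝ) * (d + 1) * (d + 4) ≤ 2 ^ 15 * ((d : ℝ) + 1) ^ 2 * ((d : ℝ) + 4) ^ 2 := by nlinarith
      have hL2b : 0 ≤ (L : ℝ) ^ 2 * b := by positivity
      nlinarith
    linarith
  have hreg' : Regular d L N b (MinimalActionRefine.gradConst d c) (k + 1) UB := hreg.regular
  obtain ⟨hWu, -, hWsm⟩ := rescale_bavg_mem_sfClass hL hb hbs le_rfl hreg'
  have hbW : 0 ≤ b + 226 * (8 * (d + 1) * (d + 4)) ^ 2 * b ^ 2 := by positivity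
  have hcW : 0 ≤ 2 * (c + curConst d L * b ^ 2) := by
    have := curConst_nonneg (d := d) L
    positivity
  have hG : ∀ (p : Site d) (μ : Fin d) {κ ν : Fin d}, κ ≠ ν →
      ‖Ad (rescale L (bavg L UB) p μ) ((hol (rescale L (bavg L UB)) (p + e μ) (plaqWord κ ν) : (Matrix n n ℂ)ˣ) : Matrix n n ℂ)
        - ((hol (rescale L (bavg L UB)) p (plaqWord κ ν) : (Matrix n n ℂ)ˣ) : Matrix n n ℂ)‖ ≤
        2 * (c + curConst d L * b ^ 2) / ((L : ℝ) ^ k) ^ 3 :=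
    fun p μ κ ν hκν => norm_plaqGrad_rescale_bavg_le_scaled hL hreg.unitary hb hRb hreg.small hreg.grad p μ hκν
  exact reg335Zd_of_smallField_plaqGrad hWu hL k hbW hcW hM hsmall hWsm hG h𝒬 hC

/-- **(3.35) FOR A SUP-REGULAR CONFIGURATION** (e.g. the minimiser `U_A` at level `k`): `RegularSup d L N b c k U`, `b∕(Lᵏ)² ≤ ¼`, a cube family
`𝒬` (`j ≤ k`, `ℓ¹`-radius `≤ M·Lʲ`) with `(M+1)b ≤ ½`, and any `C > 2(M+1)b + 4Mc + 4M(1+2M)b²` ⇒ `Reg335Zd (Lᵏ)⁻¹ L 𝒬 C U` (radii `(b, 2c)`,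
`NE3FluxGradientDictionary`). [folklore] -/
theorem reg335Zd_of_regularSup [Nonempty n] {L N : ℕ} (hL : 1 ≤ L) {k : ℕ} {U : Site d → Fin d → (Matrix n n ℂ)ˣ} {b c : ℝ}
    (hreg : RegularSup d L N b c k U) (hb : 0 ≤ b) (hc : 0 ≤ c) (hb4 : b / ((L : ℝ) ^ k) ^ 2 ≤ 1 / 4)
    {M : ℝ} (hM : 0 ≤ M) (hsmall : (M + 1) * b ≤ 1 / 2)
    {𝒬 : Set (Set (Site d) × ℕ)}
    (h𝒬 : ∀ q ∈ 𝒬, q.2 ≤ k ∧ ∃ y : Site d, ∀ z ∈ q.1, (l1 (z - y) : ℝ) ≤ M * (L : ℝ) ^ q.2)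
    {C : ℝ} (hC : 2 * (M + 1) * b + 2 * M * (2 * c) + 4 * M * (1 + 2 * M) * b ^ 2 < C) :
    Reg335Zd (((L : ℝ) ^ k)⁻¹) L 𝒬 C U := by
  have hG : ∀ (p : Site d) (μ : Fin d) {κ ν : Fin d}, κ ≠ ν →
      ‖Ad (U p μ) ((hol U (p + e μ) (plaqWord κ ν) : (Matrix n n ℂ)ˣ) : Matrix n n ℂ)
        - ((hol U p (plaqWord κ ν) : (Matrix n n ℂ)ˣ) : Matrix n n ℂ)‖ ≤ (2 * c) / ((L : ℝ) ^ k) ^ 3 := by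
    intro p μ κ ν hκν
    have h := norm_Ad_hol_sub_hol_le_of_fluxGrad hreg.unitary hreg.small hb4 hreg.grad p μ hκν
    rwa [← mul_div_assoc] at h
  exact reg335Zd_of_smallField_plaqGrad hreg.unitary hL k hb (by positivity) hM hsmall hreg.small hG h𝒬 hC

/-- **(3.35) FOR THE GAUGE COPY `U^{u₀}`** of a sup-regular configuration, any unitary-valued site gauge `u₀` (e.g. the pinned axial pre-gauge
`u₀ = ptw L W U_A k` of `PairAxialGaugeB8`): the class (3.35) is gauge invariant (`B9Eq335AxialCriterion.reg335Zd_gaugeAct`). [folklore] -/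
theorem reg335Zd_gaugeAct_of_regularSup [Nonempty n] {L N : ℕ} (hL : 1 ≤ L) {k : ℕ} {U : Site d → Fin d → (Matrix n n ℂ)ˣ} {b c : ℝ}
    (hreg : RegularSup d L N b c k U) (hb : 0 ≤ b) (hc : 0 ≤ c) (hb4 : b / ((L : ℝ) ^ k) ^ 2 ≤ 1 / 4)
    {M : ℝ} (hM : 0 ≤ M) (hsmall : (M + 1) * b ≤ 1 / 2)
    {𝒬 : Set (Set (Site d) × ℕ)}
    (h𝒬 : ∀ q ∈ 𝒬, q.2 ≤ k ∧ ∃ y : Site d, ∀ z ∈ q.1, (l1 (z - y) : ℝ) ≤ M * (L : ℝ) ^ q.2)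
    {C : ℝ} (hC : 2 * (M + 1) * b + 2 * M * (2 * c) + 4 * M * (1 + 2 * M) * b ^ 2 < C)
    {u₀ : Site d → (Matrix n n ℂ)ˣ} (hu₀ : ∀ x, u₀ x ∈ unitaryUnits (Matrix n n ℂ)) :
    Reg335Zd (((L : ℝ) ^ k)⁻¹) L 𝒬 C (gaugeAct u₀ U) := by
  letI : CStarAlgebra (Matrix n n ℂ) := {}
  exact reg335Zd_gaugeAct (reg335Zd_of_regularSup hL hreg hb hc hb4 hM hsmall h𝒬 hC) fun x => mem_U1_of_unitary (hu₀ x)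

/-! ## §3 The capstone re-issued: [B8] Theorem 4 applies at the pair, with the CONCRETE `Reg := Reg335Zd` and no background hypothesis -/

/-- **[B8] THEOREM 4 APPLIES AT THE MINIMISER PAIR — WITH (1.33)'s SECOND CLAUSE DISCHARGED.**  Hypotheses: those of
`PairThm4AtB8.concl_of_thm4At_minimisers` (the pair over `sfClass d L N ε`, the (H3ˢᵘᵖ) letters of `U_A`, `U_B`, the regime lines, one letter `α`
above the radii, `Thm4At` at level `k` with `α + 11d²α ≤ c₁`) EXCEPT `Reg W`, which is replaced by: `Reg := Reg335Zd (Lᵏ)⁻¹ L 𝒬 C` for a cube family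
`𝒬` (indices `j ≤ k`, `ℓ¹`-radius `≤ Mc·Lʲ`) with `(Mc+1)·α_W ≤ ½` and `C` above the threshold of `reg335Zd_rescale_bavg`.  Conclusion: exactly one
unitary `u` with `Restr W u` and `Concl α (11d²α) W U′ u`, `U′ = U_A^{u₀}·W⁻¹`, `u₀ = ptw L W U_A k`. [folklore] -/
theorem concl_of_thm4At_minimisers_reg335 [Nonempty n] (hd : 1 ≤ d) {L N : ℕ} (hL : 2 ≤ L) {ε b c α : ℝ} {k : ℕ}
    {V UA UB : Site d → Fin d → (Matrix n n ℂ)ˣ}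
    (hA : IsMinimiser d (sfClass d L N ε) L N k V UA) (hB : IsMinimiser d (sfClass d L N ε) L N (k + 1) V UB)
    (hregA : RegularSup d L N b c k UA) (hregB : RegularSup d L N b c (k + 1) UB) (hε : 0 ≤ ε) (hb : 0 ≤ b) (hc : 0 ≤ c)
    (hb4 : b / ((L : ℝ) ^ k) ^ 2 ≤ 1 / 4) (hRb : 2 ^ 15 * ((d : ℝ) + 1) ^ 2 * ((d : ℝ) + 4) ^ 2 * (L : ℝ) ^ 2 * b ≤ 1)
    (hα : 0 < α) (hεα : ε < α) (hbα : b + 226 * (8 * (d + 1) * (d + 4)) ^ 2 * b ^ 2 < α)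
    (hcα : 4 * ((d : ℝ) - 1) * (c + curConst d L * b ^ 2) < α)
    (hα3 : C0 d * α ≤ 1 / 3) (hα2 : 2 * α ≤ c2' d L) (hsmall : 11 * (d : ℝ) ^ 2 * α ≤ 1 / 6)
    {c₁ : ℝ} {a : Site d} {M ρ : ℕ}
    {Mc : ℝ} (hMc : 0 ≤ Mc) (hMcα : (Mc + 1) * (b + 226 * (8 * (d + 1) * (d + 4)) ^ 2 * b ^ 2) ≤ 1 / 2)
    {𝒬 : Set (Set (Site d) × ℕ)}
    (h𝒬 : ∀ q ∈ 𝒬, q.2 ≤ k ∧ ∃ y : Site d, ∀ z ∈ q.1, (l1 (z - y) : ℝ) ≤ Mc * (L : ℝ) ^ q.2)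
    {C : ℝ} (hC : 2 * (Mc + 1) * (b + 226 * (8 * (d + 1) * (d + 4)) ^ 2 * b ^ 2) + 2 * Mc * (2 * (c + curConst d L * b ^ 2)) +
      4 * Mc * (1 + 2 * Mc) * (b + 226 * (8 * (d + 1) * (d + 4)) ^ 2 * b ^ 2) ^ 2 < C)
    {Restr : (Site d → Fin d → (Matrix n n ℂ)ˣ) → (Site d → (Matrix n n ℂ)ˣ) → Prop}
    {Concl : ℝ → ℝ → (Site d → Fin d → (Matrix n n ℂ)ˣ) → (Site d → Fin d → (Matrix n n ℂ)ˣ) → (Site d → (Matrix n n ℂ)ˣ) → Prop}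
    (hThm4 : Thm4At L k (((L : ℝ) ^ k)⁻¹) c₁ (unitaryUnits (Matrix n n ℂ)) a M ρ
      (Reg335Zd (((L : ℝ) ^ k)⁻¹) L 𝒬 C) Restr Concl)
    (hc₁ : α + 11 * (d : ℝ) ^ 2 * α ≤ c₁) :
    ∃ u : Site d → (Matrix n n ℂ)ˣ,
      ((∀ x, u x ∈ unitaryUnits (Matrix n n ℂ)) ∧ Restr (rescale L (bavg L UB)) u ∧
        Concl α (11 * (d : ℝ) ^ 2 * α) (rescale L (bavg L UB))
          (pert (gaugeAct (ptw L (rescale L (bavg L UB)) UA k) UA) (rescale L (bavg L UB))) u) ∧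
      ∀ u' : Site d → (Matrix n n ℂ)ˣ, (∀ x, u' x ∈ unitaryUnits (Matrix n n ℂ)) → Restr (rescale L (bavg L UB)) u' →
        Concl α (11 * (d : ℝ) ^ 2 * α) (rescale L (bavg L UB))
          (pert (gaugeAct (ptw L (rescale L (bavg L UB)) UA k) UA) (rescale L (bavg L UB))) u' → u' = u := by
  have hL1 : 1 ≤ L := le_trans (by norm_num) hL
  have hReg : Reg335Zd (((L : ℝ) ^ k)⁻¹) L 𝒬 C (rescale L (bavg L UB)) :=
    reg335Zd_rescale_bavg hL1 hregB hb hc hRb hMc hMcα h𝒬 hC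
  exact concl_of_thm4At_minimisers hd hL hA hB hregA hregB hε hb hc hb4 hRb hα hεα hbα hcα hα3 hα2 hsmall hThm4 hc₁ hReg

end

end Summit.QuantumFields.BalabanUV.T4Continuum.NE3.PairReg335B8
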